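import Mathlib
import Literature.NumberTheory.DiophantineGeometry.AbcWave0
import Literature.NumberTheory.DiophantineGeometry.PastenSubexpTheorem14
import Summits.ABC.ABC.Theorems.ThreeSlotZooSquareSquare
import Summits.ABC.ABC.Theorems.SolvedZooL3Reduction

/-!
# Family L3 of the three-prime zoo is the singleton `(1, 242, 243)` modulo Ljunggren 1943

Consumer file for `SolvedZooABC` (stmt-ABC-24025, `route-ABC-ThreeSlotCyclotomicDescent`),
family (iii) of the typed statement, in both orientations:
`a = 1, b = 2^x · q², c = r^z` (`q, r` prime, `r` odd, `z` odd, `3 ≤ z`), i.e. `r^z = 2^x q² + 1`.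

WHICH CONJUNCT, MODULO WHICH FACT. This file discharges the family-(iii) (= L3) disjunct of
stmt-ABC-24025 — and nothing else — MODULO ONE PRINTED THEOREM NOT PROVED IN THE TREE, entering
as the explicit hypothesis `hL` whose Prop text is, verbatim, the statement the typer seat
(abc-harv-typ-1, KEY ZOO-FACTS) files as the Literature named fact
`Literature.NumberTheory.DiophantineGeometry.ljunggren1943_geomSumEqSquare`:

  `∀ x n y : ℕ, 1 < x → 2 < n → (Finset.range n).sum (fun i => x ^ i) = y ^ 2 →
     (x, n, y) = (3, 5, 11) ∨ (x, n, y) = (7, 4, 20)`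

— Ljunggren 1943, "(xⁿ − 1)/(x − 1) = y², x > 1, n > 2 has only the solutions (3, 5, 11) and
(7, 4, 20)" (W. Ljunggren, Norsk Mat. Tidsskr. 25 (1943) 17–20; secondary: Shorey–Tijdeman,
*Exponential Diophantine equations*, Cambridge 1986, p. 178). The hypothesis is stated INLINE
(no `def`, no new named fact in this file); once the Literature module lands, the by-name
corollary is a one-line follow-up (`solvedZoo_L3 (hL : ljunggren1943_geomSumEqSquare)`).

Content:
* `l3_params` — under `hL`, the data of family (iii) are forced: `x = 1, q = 11, r = 3, z = 5`
  (by the unconditional reduction `SolvedZooL3Reduction.l3_reduce` + `hL`; `z` odd kills `(7,4,20)`);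
* `l3_triple_eq` / `l3_triple_eq_swap` — the triple is `(1, 242, 243)` / `(242, 1, 243)`;
* `sixtysix_le_rad` — `66 = 2·3·11 ≤ rad(1 · 242 · 243)` (in fact equality; the bound suffices);
* `lt_mul_rpow_of_lt_mul` — bookkeeping `c < C·R ⇒ c < C·R^(1+ε)` for `R ≥ 1`;
* `solvedZoo_L3_of hL` — `SolvedZooABC` restricted to family (iii) ∨ its swap, with the explicit
  constant `C = 10` for every `ε > 0` (`243 < 10 · 66`).

HONESTY: PROVED-MOD-FACT, not proved — stmt-ABC-24025 stays OPEN; this is the L3 conjunct modulo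
Ljunggren 1943 (unproved in the tree; primary source not held, acq-13751). INPUTS→UNCONDITIONAL
(D-0154 (2)) bookkeeping: not abc, not the cell B₃, abc moved by 0; typed ≠ proved.
-/

namespace Summit.ABC.ABC.Theorems.SolvedZooL3Consumer

open Finset
open Literature.NumberTheory.DiophantineGeometry (IsABCTriple rad rad_def rad_swap)
open UniqueFactorizationMonoid (radical)
open Summit.ABC.ABC.Theorems.ThreeSlotZooSquareSquare (mul_dvd_radical)
open Summit.ABC.ABC.Theorems.SolvedZooL3Reduction (l3_reduce)

/-- **Parameters of family (iii) modulo Ljunggren 1943.** If `r ^ z = 2 ^ x * q ^ 2 + 1` with `q`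
prime, `1 < r`, `z` odd, `3 ≤ z`, then — assuming Ljunggren's 1943 theorem `hL` (inline; to become
`Literature.NumberTheory.DiophantineGeometry.ljunggren1943_geomSumEqSquare`) — necessarily
`x = 1`, `q = 11`, `r = 3`, `z = 5` (`3⁵ = 2·11² + 1`). -/
theorem l3_params
    (hL : ∀ x n y : ℕ, 1 < x → 2 < n → (Finset.range n).sum (fun i => x ^ i) = y ^ 2 →
      (x, n, y) = (3, 5, 11) ∨ (x, n, y) = (7, 4, 20))
    {x q r z : ℕ} (hq : q.Prime) (hr : 1 < r) (hz : Odd z) (h3 : 3 ≤ z)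
    (h : r ^ z = 2 ^ x * q ^ 2 + 1) :
    x = 1 ∧ q = 11 ∧ r = 3 ∧ z = 5 := by
  obtain ⟨hS, hr'⟩ := l3_reduce hq hr hz h3 h
  rcases hL r z q hr (by omega) hS with h1 | h1
  · simp only [Prod.mk.injEq] at h1
    obtain ⟨rfl, rfl, rfl⟩ := h1
    refine ⟨?_, rfl, rfl, rfl⟩
    have h2 : 2 ^ x = 2 ^ 1 := by omega
    exact Nat.pow_right_injective le_rfl h2
  · simp only [Prod.mk.injEq] at h1
    obtain ⟨-, rfl, -⟩ := h1
    exact absurd hz (by decide)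

/-- **Family (iii) is the single triple `(1, 242, 243)`** modulo Ljunggren 1943 (`hL`, inline). -/
theorem l3_triple_eq
    (hL : ∀ x n y : ℕ, 1 < x → 2 < n → (Finset.range n).sum (fun i => x ^ i) = y ^ 2 →
      (x, n, y) = (3, 5, 11) ∨ (x, n, y) = (7, 4, 20))
    {a b c : ℕ} (ht : IsABCTriple a b c)
    (hfam : ∃ x q r z : ℕ, q.Prime ∧ r.Prime ∧ Odd r ∧ Odd z ∧ 3 ≤ z ∧ a = 1 ∧
      b = 2 ^ x * q ^ 2 ∧ c = r ^ z) :
    a = 1 ∧ b = 242 ∧ c = 243 := by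
  obtain ⟨x, q, r, z, hq, hr, -, hz, h3, rfl, rfl, rfl⟩ := hfam
  have h : r ^ z = 2 ^ x * q ^ 2 + 1 := by have := ht.2.2.1; omega
  obtain ⟨rfl, rfl, rfl, rfl⟩ := l3_params hL hq hr.one_lt hz h3 h
  norm_num

/-- The swapped orientation: family (iii) with `b = 1` is the single triple `(242, 1, 243)`
modulo Ljunggren 1943 (`hL`, inline). -/
theorem l3_triple_eq_swap
    (hL : ∀ x n y : ℕ, 1 < x → 2 < n → (Finset.range n).sum (fun i => x ^ i) = y ^ 2 →
      (x, n, y) = (3, 5, 11) ∨ (x, n, y) = (7, 4, 20))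
    {a b c : ℕ} (ht : IsABCTriple a b c)
    (hfam : ∃ x q r z : ℕ, q.Prime ∧ r.Prime ∧ Odd r ∧ Odd z ∧ 3 ≤ z ∧ b = 1 ∧
      a = 2 ^ x * q ^ 2 ∧ c = r ^ z) :
    a = 242 ∧ b = 1 ∧ c = 243 := by
  obtain ⟨x, q, r, z, hq, hr, -, hz, h3, rfl, rfl, rfl⟩ := hfam
  have h : r ^ z = 2 ^ x * q ^ 2 + 1 := by have := ht.2.2.1; omega
  obtain ⟨rfl, rfl, rfl, rfl⟩ := l3_params hL hq hr.one_lt hz h3 h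
  norm_num

/-- `rad(1 · 242 · 243) ≥ 66 = 2 · 3 · 11` (the three primes of `2 · 11² · 3⁵` divide the radical;
in fact `rad = 66`, but the lower bound is all that is used). [folklore] -/
theorem sixtysix_le_rad : 66 ≤ rad 1 242 243 := by
  rw [rad_def]
  have h : 2 * 3 * 11 ∣ radical (1 * 242 * 243 : ℕ) :=
    mul_dvd_radical Nat.prime_two Nat.prime_three (by norm_num) (by norm_num) (by norm_num)
      (by norm_num) (by norm_num) (by norm_num) (by norm_num) (by norm_num)
  exact Nat.le_of_dvd (Nat.radical_pos _) h

/-- Bookkeeping: an `ε`-free bound `c < C · R` with `R ≥ 1`, `C ≥ 0` gives the abc(ε) shape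
`c < C · R^(1+ε)` for every `ε > 0`. [folklore] -/
theorem lt_mul_rpow_of_lt_mul {c R : ℕ} {C : ℝ} (hR : 1 ≤ R) (hC : 0 ≤ C)
    (h : (c : ℝ) < C * (R : ℝ)) {ε : ℝ} (hε : 0 < ε) :
    (c : ℝ) < C * ((R : ℕ) : ℝ) ^ (1 + ε) := by
  have hR' : (1 : ℝ) ≤ (R : ℝ) := by exact_mod_cast hR
  have hle : (R : ℝ) ≤ (R : ℝ) ^ (1 + ε) := by
    calc (R : ℝ) = (R : ℝ) ^ (1 : ℝ) := (Real.rpow_one _).symm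
      _ ≤ (R : ℝ) ^ (1 + ε) := Real.rpow_le_rpow_of_exponent_le hR' (by linarith)
  exact lt_of_lt_of_le h (mul_le_mul_of_nonneg_left hle hC)

/-- **`SolvedZooABC` restricted to family (iii) = L3 (both orientations), modulo Ljunggren 1943.**
For every `ε > 0` the constant `C = 10` works: the family is `{(1, 242, 243)}` ∪ swap and
`243 < 10 · 66 ≤ 10 · rad ≤ 10 · rad^(1+ε)`. The hypothesis `hL` is Ljunggren's 1943 theorem,
verbatim the Prop the typer files as `ljunggren1943_geomSumEqSquare` (INLINE here; a printed
theorem NOT proved in the tree). PROVED-MOD-FACT ≠ proved; this is the L3 conjunct of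
stmt-ABC-24025 only. -/
theorem solvedZoo_L3_of
    (hL : ∀ x n y : ℕ, 1 < x → 2 < n → (Finset.range n).sum (fun i => x ^ i) = y ^ 2 →
      (x, n, y) = (3, 5, 11) ∨ (x, n, y) = (7, 4, 20)) :
    ∀ ε : ℝ, 0 < ε → ∃ C : ℝ, 0 < C ∧ ∀ a b c : ℕ, IsABCTriple a b c →
      ((∃ x q r z : ℕ, q.Prime ∧ r.Prime ∧ Odd r ∧ Odd z ∧ 3 ≤ z ∧ a = 1 ∧
          b = 2 ^ x * q ^ 2 ∧ c = r ^ z) ∨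
       (∃ x q r z : ℕ, q.Prime ∧ r.Prime ∧ Odd r ∧ Odd z ∧ 3 ≤ z ∧ b = 1 ∧
          a = 2 ^ x * q ^ 2 ∧ c = r ^ z)) →
      (c : ℝ) < C * ((rad a b c : ℕ) : ℝ) ^ (1 + ε) := by
  intro ε hε
  refine ⟨10, by norm_num, ?_⟩
  rintro a b c ht (hfam | hfam)
  · obtain ⟨rfl, rfl, rfl⟩ := l3_triple_eq hL ht hfam
    have h66 : (66 : ℝ) ≤ (rad 1 242 243 : ℕ) := by exact_mod_cast sixtysix_le_rad
    exact lt_mul_rpow_of_lt_mul (le_trans (by norm_num) sixtysix_le_rad) (by norm_num)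
      (by push_cast; linarith) hε
  · obtain ⟨rfl, rfl, rfl⟩ := l3_triple_eq_swap hL ht hfam
    have hsw : rad 242 1 243 = rad 1 242 243 := rad_swap 1 242 243
    have h66 : (66 : ℝ) ≤ (rad 242 1 243 : ℕ) := by rw [hsw]; exact_mod_cast sixtysix_le_rad
    exact lt_mul_rpow_of_lt_mul (le_trans (by norm_num) (hsw ▸ sixtysix_le_rad)) (by norm_num)
      (by push_cast; linarith) hε

end Summit.ABC.ABC.Theorems.SolvedZooL3Consumer
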